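import Mathlib
import Summits.ResolutionOfSingularities.ResolutionOfSingularities.Theorems.WeightedInvariantLocalWeightedDropTOT2BridgeCurve
import Summits.ResolutionOfSingularities.ResolutionOfSingularities.Theorems.WeightedInvariantLocalWeightedDropTOT2BridgeDecorated
import Summits.ResolutionOfSingularities.ResolutionOfSingularities.Theorems.WeightedInvariantLocalWeightedDropTOT2BridgeCurvePermissible

/-!
# `WeightedInvariant.LocalWeightedDrop`, residual T″|₄ (skeleton v32, registered stub `stub_spaceNCRankDrop`): TOT2-LINE piece S-E2,
# (E2-c)/(G1) — the δ-ADAPTER FOR THE CURVE MOVES `V(y, u_i)`: the successor monic form IS the new decoration's `f′ · ∏_{O′} x_l`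

Crux item stmt-ResolutionOfSingularities-8899 `LocalWeightedDrop`; line TOT2-LINE v1.2 of res-L1-w43-lead-1 (`L/res-L1-w43-lead-1/g4/TOT2-LINE.md`
§5 (E2-c), ADDENDUM v1.2 (G1) «run the S-E2′ region on δ-data … and carry b by S-SET `admissible_transform`»).  The CURVE twin of
…TOT2BridgeDecorated (p534033, point move): there `totalO_transform_eq_of_near` reads the new decoration after a POINT blow-up; here the same for
the blow-ups of the curves `V(y, u_i)` of the presenting coordinates (the `divOneT`/`divTwoT` moves of `PolyDescent.succT`), on the curve brick
…MonicCurveBlowup (`transform_curve`, `constantCoeff_g₀`, `not_X_dvd_g₀`, `slice_g₀`) and …TOT2BridgeCurve (`subst_chart_prod_X`), over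
res-L1-w43-stub-1's S-SET (…NCResSettingDefs/…Strict/…Admissible/…Near).  [OURS · L1 W4.3, chain w43, res-L1-w43-stub-2 (gen 5); nothing about
any manuscript; definition-free; AI-written, gate-checked, weaker than expert review.]

SETTING.  `(Φ₀, 𝟙_{u_i,y})` B-permissible for `δ = (f, E, O)` (…TOT2BridgePermissible `isBPermissible_curve_of_presentation'`), `f ≠ 0`, a
presentation `(f · ∏_{l∈O} x_l) ∘ Φ₀ = U · (y^d + Σ_j A_j y^j)` with `U(0) ≠ 0`, `A_j = u_i^{d−j} · A′_j`, `ord A_j > d − j`; an answer `pt` of the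
move (convention `pt_l = 0` off the centre), `γ := pt(y)`, `c_i := pt(u_i)`.
* `satPart_fChart_curve_mul_eq` — THE CORE IDENTITY: `satPart(f∘Φ₀∘chart) · W · ∏_{l∈O} (pt_{σl} + y_{σl}) = (U∘chart) · g₀` for a unit `W`,
  `σ = strIdx Φ₀`, `g₀ = (γ + Y)^d + Σ_j (c_i + y_i)^{d−j} · (A′_j∘chart′) · (γ + Y)^j` the curve brick's bracket;
* `constantCoeff_strict_curve_ne_zero_of_gamma_ne_zero`, `o_transform_curve_eq_zero_of_gamma_ne_zero` — answers with `γ ≠ 0` are HEAD DROPS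
  (the sliced strict transform at any live slot is a unit, `o′ = 0`);
* `castSucc_ne_zero_of_curveAnswer` — at `γ = 0` the live slot is `u_i` (`c_i ≠ 0`);
* `strict_curve_mul_prod_eq_of_gamma_eq_zero` — at `γ = 0`: `strict · ∏_{l∈O, pt_{σl}=0} x_{σl↓} = V · (y^d + Σ_j c_i^{d−j}·(A′_j ∘ chart′_{e_i}(c_i))|_i · y^j)`,
  `V(0) ≠ 0` — verbatim the successor dressed form of `moveClause_curve_dressedMonic`, so …TOT2BridgeLabels' `monicForm_curveSucc_zero/one`
  (`m = 2`) identify it with `c_i^d · Θ^*(monic form of A′)` (`A′ = divOneT/divTwoT` of the label);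
* **`totalO_transform_curve_eq_of_near`** — at a NEAR answer (`o′ = o`): `f′ · ∏_{l∈O′} x_l = V · (that successor monic form)` — the presentation
  `hP` of the next step after `Θ⁻¹` (`exists_legal_inverse`);
* `o_transform_curve_eq_zero_of_gamma_ne_zero'`, `totalO_transform_curve_eq_of_near'` — the same two readings from a POINT-B-permissible
  presenting `Φ₀` (the shape of res-L1-w43-lead-1's `DPres`), the curve B-permissibility being supplied by lead-1's
  `isBPermissible_curve_of_presentation` (…TOT2BridgeCurvePermissible, p535609).
-/

set_option linter.dupNamespace false -- mandated namespace of this single-conjunct summit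
set_option autoImplicit false

namespace Summit.ResolutionOfSingularities.ResolutionOfSingularities.Theorems

open Literature.AlgebraicGeometry.Resolution
open Literature.AlgebraicGeometry.Resolution.CobordantGame

namespace TameFourTupleDrop

open MvPowerSeries MonicCurveBlowup

variable {k : Type} [Field k] {m : ℕ}

/-- Under the convention of the move clause, an answer of the curve move `V(y,u_i)` with `γ = pt(y) = 0` has `pt(u_i) ≠ 0`. -/
theorem castSucc_ne_zero_of_curveAnswer (i : Fin m) {pt : Fin (m + 1) → k}
    (hconv : ∀ l, (fun l : Fin (m + 1) => if l = Fin.castSucc i ∨ l = Fin.last m then (1 : ℕ) else 0) l = 0 → pt l = 0)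
    (hpt : pt ≠ 0) (hγ : pt (Fin.last m) = 0) : pt (Fin.castSucc i) ≠ 0 := by
  intro h0
  apply hpt
  funext l
  by_cases h1 : l = Fin.castSucc i
  · rw [h1]; exact h0
  by_cases h2 : l = Fin.last m
  · rw [h2]; exact hγ
  · exact hconv l (by dsimp only; rw [if_neg (not_or.mpr ⟨h1, h2⟩)])

section Core

variable {δ : Decoration k m} {Φ₀ : Fin (m + 1) → MvPowerSeries (Fin (m + 1)) k} {d : ℕ} {i : Fin m}
  {A A' : Fin d → MvPowerSeries (Fin m) k} {U : MvPowerSeries (Fin (m + 1)) k}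

/-- **THE CORE IDENTITY OF THE CURVE MOVE `V(y, u_i)` AT AN ANSWER.**  For `(Φ₀, 𝟙_{u_i,y})` B-permissible, `f ≠ 0`, a presentation
`(f · ∏_{l∈O} x_l) ∘ Φ₀ = U · (y^d + Σ_j A_j y^j)` with `A_j = u_i^{d−j} A′_j`, and an answer `pt` (convention `pt_l = 0` off the centre):
`satPart(f∘Φ₀∘chart) · W · ∏_{l∈O} (pt_{σl} + y_{σl}) = (U∘chart) · g₀` for a unit `W` (`σ = strIdx Φ₀`, `g₀` the curve brick's bracket). [OURS · L1 W4.3] -/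
theorem satPart_fChart_curve_mul_eq
    (hperm : IsBPermissible δ Φ₀ (fun l : Fin (m + 1) => if l = Fin.castSucc i ∨ l = Fin.last m then (1 : ℕ) else 0)) (hf : δ.f ≠ 0)
    (hU : constantCoeff U ≠ 0)
    (hP : subst Φ₀ (δ.f * ∏ l ∈ δ.O, X l) =
      U * (X (Fin.last m) ^ d + ∑ j : Fin d, rename (Fin.succAboveEmb (Fin.last m)) (A j) * X (Fin.last m) ^ (j : ℕ)))
    (hdiv : ∀ j, A j = X i ^ (d - (j : ℕ)) * A' j) (pt : Fin (m + 1) → k)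
    (hconv : ∀ l, (fun l : Fin (m + 1) => if l = Fin.castSucc i ∨ l = Fin.last m then (1 : ℕ) else 0) l = 0 → pt l = 0) :
    ∃ W : MvPowerSeries (Fin (m + 1 + 1)) k, constantCoeff W ≠ 0 ∧
      satPart (δ.fChart Φ₀ (fun l : Fin (m + 1) => if l = Fin.castSucc i ∨ l = Fin.last m then (1 : ℕ) else 0) pt) * W *
          ∏ l ∈ δ.O, (C (pt (strIdx Φ₀ l)) + X (strIdx Φ₀ l).succ) =
        subst (CobordantChart.chart (fun l : Fin (m + 1) => if l = Fin.castSucc i ∨ l = Fin.last m then (1 : ℕ) else 0) pt) U *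
          ((C (pt (Fin.last m)) + X (Fin.last (m + 1))) ^ d +
            ∑ j : Fin d, (C (pt (Fin.castSucc i)) + X (Fin.castSucc i).succ) ^ (d - (j : ℕ)) *
              rename (Fin.succAboveEmb (Fin.last (m + 1)))
                (subst (cruxChart k (fun l : Fin m => if l = i then (1 : ℕ) else 0) (fun l => pt (Fin.castSucc l))) (A' j)) *
              (C (pt (Fin.last m)) + X (Fin.last (m + 1))) ^ (j : ℕ)) := by
  classical
  set Wt : Fin (m + 1) → ℕ := fun l => if l = Fin.castSucc i ∨ l = Fin.last m then (1 : ℕ) else 0 with hWt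
  obtain ⟨hmv, -, -, hP3⟩ := hperm
  have hΦs : HasSubst Φ₀ := hasSubst_of_constantCoeff_zero hmv.1
  have hch := CobordantChart.hasSubst_chart Wt pt hconv
  -- the straightening units of the old letters
  have hstr : ∀ l ∈ δ.O, ∃ u : MvPowerSeries (Fin (m + 1)) k, constantCoeff u ≠ 0 ∧ Φ₀ l = u * X (strIdx Φ₀ l) :=
    fun l hl => strIdx_spec (hP3 l (δ.O_subset hl))
  choose! u hu using hstr
  -- the chart transform of the presentation
  have hfChart_ne : δ.fChart Φ₀ Wt pt ≠ 0 := Decoration.fChart_ne_zero hmv hconv hf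
  obtain ⟨hsat, hndvd⟩ := satExp_satPart_spec hfChart_ne
  have hT := transform_curve i A A' hdiv pt
  have hcc : cruxChart k Wt pt = CobordantChart.chart Wt pt := CobordantArc.cruxChart_eq_chart_of_convention Wt pt hconv
  rw [hcc] at hT
  have hl : ∀ l ∈ δ.O, subst (CobordantChart.chart Wt pt) (subst Φ₀ (X l : MvPowerSeries (Fin (m + 1)) k)) =
      subst (CobordantChart.chart Wt pt) (u l) * (X 0 ^ Wt (strIdx Φ₀ l) * (C (pt (strIdx Φ₀ l)) + X (strIdx Φ₀ l).succ)) := by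
    intro l hlO
    rw [subst_X hΦs, (hu l hlO).2, ← coe_substAlgHom hch, map_mul, coe_substAlgHom, subst_X hch, CobordantChart.chart_apply]
  have key : X 0 ^ (satExp (δ.fChart Φ₀ Wt pt) + ∑ l ∈ δ.O, Wt (strIdx Φ₀ l)) *
      (satPart (δ.fChart Φ₀ Wt pt) * (∏ l ∈ δ.O, subst (CobordantChart.chart Wt pt) (u l)) *
        ∏ l ∈ δ.O, (C (pt (strIdx Φ₀ l)) + X (strIdx Φ₀ l).succ)) =
      X 0 ^ d * (subst (CobordantChart.chart Wt pt) U *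
        ((C (pt (Fin.last m)) + X (Fin.last (m + 1))) ^ d +
          ∑ j : Fin d, (C (pt (Fin.castSucc i)) + X (Fin.castSucc i).succ) ^ (d - (j : ℕ)) *
            rename (Fin.succAboveEmb (Fin.last (m + 1)))
              (subst (cruxChart k (fun l : Fin m => if l = i then (1 : ℕ) else 0) (fun l => pt (Fin.castSucc l))) (A' j)) *
            (C (pt (Fin.last m)) + X (Fin.last (m + 1))) ^ (j : ℕ))) := by
    have h := congrArg (subst (CobordantChart.chart Wt pt)) hP
    rw [← coe_substAlgHom hΦs, map_mul, map_prod, coe_substAlgHom, ← coe_substAlgHom hch, map_mul, map_mul, map_prod, coe_substAlgHom,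
      hT, Finset.prod_congr rfl hl, Finset.prod_mul_distrib, Finset.prod_mul_distrib, Finset.prod_pow_eq_pow_sum] at h
    change δ.fChart Φ₀ Wt pt * _ = _ at h
    rw [hsat] at h
    linear_combination h
  have hW0 : constantCoeff (∏ l ∈ δ.O, subst (CobordantChart.chart Wt pt) (u l)) ≠ 0 := by
    rw [map_prod]
    refine Finset.prod_ne_zero_iff.mpr fun l hlO => ?_
    rw [constantCoeff_subst_of_constantCoeff_zero _ (CobordantArc.constantCoeff_chart _ pt hconv) (u l)]
    exact (hu l hlO).1
  have hprime := MvPowerSeries.prime_X' k (0 : Fin (m + 1 + 1))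
  have hL : ¬ X 0 ∣ satPart (δ.fChart Φ₀ Wt pt) * (∏ l ∈ δ.O, subst (CobordantChart.chart Wt pt) (u l)) *
      ∏ l ∈ δ.O, (C (pt (strIdx Φ₀ l)) + X (strIdx Φ₀ l).succ) := by
    intro h
    rcases hprime.dvd_or_dvd h with h | h
    · rcases hprime.dvd_or_dvd h with h | h
      · exact hndvd h
      · exact not_X_dvd_of_constantCoeff_ne_zero hW0 h
    · obtain ⟨l, -, hl'⟩ := (hprime.dvd_finsetProd_iff _).mp h
      exact not_X_zero_dvd_C_add_X_succ _ _ hl'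
  have hUc : constantCoeff (subst (CobordantChart.chart Wt pt) U) ≠ 0 := by
    rw [constantCoeff_subst_of_constantCoeff_zero _ (CobordantArc.constantCoeff_chart _ pt hconv) U]; exact hU
  have hR : ¬ X 0 ∣ subst (CobordantChart.chart Wt pt) U *
      ((C (pt (Fin.last m)) + X (Fin.last (m + 1))) ^ d +
        ∑ j : Fin d, (C (pt (Fin.castSucc i)) + X (Fin.castSucc i).succ) ^ (d - (j : ℕ)) *
          rename (Fin.succAboveEmb (Fin.last (m + 1)))
            (subst (cruxChart k (fun l : Fin m => if l = i then (1 : ℕ) else 0) (fun l => pt (Fin.castSucc l))) (A' j)) *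
          (C (pt (Fin.last m)) + X (Fin.last (m + 1))) ^ (j : ℕ)) := by
    intro h
    rcases hprime.dvd_or_dvd h with h | h
    · exact not_X_dvd_of_constantCoeff_ne_zero hUc h
    · exact not_X_dvd_g₀ i (pt (Fin.last m)) (pt (Fin.castSucc i)) _ h
  obtain ⟨-, hGG⟩ := X_pow_mul_eq_X_pow_mul 0 key hL hR
  exact ⟨∏ l ∈ δ.O, subst (CobordantChart.chart Wt pt) (u l), hW0, hGG⟩

/-- **ANSWERS OF THE CURVE MOVE WITH `γ = pt(y) ≠ 0` ARE HEAD DROPS**: the sliced strict transform (at any live slot) is a UNIT. [OURS · L1 W4.3] -/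
theorem constantCoeff_strict_curve_ne_zero_of_gamma_ne_zero
    (hperm : IsBPermissible δ Φ₀ (fun l : Fin (m + 1) => if l = Fin.castSucc i ∨ l = Fin.last m then (1 : ℕ) else 0)) (hf : δ.f ≠ 0)
    (hU : constantCoeff U ≠ 0) (hA : ∀ j : Fin d, ((d - (j : ℕ) : ℕ) : ℕ∞) < (A j).order)
    (hP : subst Φ₀ (δ.f * ∏ l ∈ δ.O, X l) =
      U * (X (Fin.last m) ^ d + ∑ j : Fin d, rename (Fin.succAboveEmb (Fin.last m)) (A j) * X (Fin.last m) ^ (j : ℕ)))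
    (hdiv : ∀ j, A j = X i ^ (d - (j : ℕ)) * A' j) {pt : Fin (m + 1) → k}
    (hconv : ∀ l, (fun l : Fin (m + 1) => if l = Fin.castSucc i ∨ l = Fin.last m then (1 : ℕ) else 0) l = 0 → pt l = 0)
    (hγ : pt (Fin.last m) ≠ 0) (i' : Fin (m + 1)) :
    constantCoeff (δ.strict Φ₀ (fun l : Fin (m + 1) => if l = Fin.castSucc i ∨ l = Fin.last m then (1 : ℕ) else 0) pt i') ≠ 0 := by
  classical
  obtain ⟨W, hW0, hcore⟩ := satPart_fChart_curve_mul_eq hperm hf hU hP hdiv pt hconv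
  have hUc : constantCoeff (subst (CobordantChart.chart
      (fun l : Fin (m + 1) => if l = Fin.castSucc i ∨ l = Fin.last m then (1 : ℕ) else 0) pt) U) ≠ 0 := by
    rw [constantCoeff_subst_of_constantCoeff_zero _ (CobordantArc.constantCoeff_chart _ pt hconv) U]; exact hU
  have hGt0 : ∀ j, constantCoeff (subst (cruxChart k (fun l : Fin m => if l = i then (1 : ℕ) else 0) (fun l => pt (Fin.castSucc l))) (A' j)) = 0 :=
    fun j => by
      rw [constantCoeff_subst_of_constantCoeff_zero _ (constantCoeff_cruxChart _ _), constantCoeff_eq_zero_of_eq_X_pow_mul i (hdiv j) (hA j)]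
  have h := congrArg (fun F => constantCoeff (TupleGame.slice i' F)) hcore
  simp only [slice_mul, map_mul, WildTerminal.constantCoeff_slice, constantCoeff_g₀ i _ _ _ hGt0] at h
  intro h0
  unfold Decoration.strict at h0
  rw [WildTerminal.constantCoeff_slice] at h0
  rw [h0, zero_mul, zero_mul] at h
  exact mul_ne_zero hUc (pow_ne_zero d hγ) h.symm

/-- Hence the new decoration at such an answer has `o′ = 0`. [OURS · L1 W4.3] -/
theorem o_transform_curve_eq_zero_of_gamma_ne_zero
    (hperm : IsBPermissible δ Φ₀ (fun l : Fin (m + 1) => if l = Fin.castSucc i ∨ l = Fin.last m then (1 : ℕ) else 0)) (hf : δ.f ≠ 0)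
    (hU : constantCoeff U ≠ 0) (hA : ∀ j : Fin d, ((d - (j : ℕ) : ℕ) : ℕ∞) < (A j).order)
    (hP : subst Φ₀ (δ.f * ∏ l ∈ δ.O, X l) =
      U * (X (Fin.last m) ^ d + ∑ j : Fin d, rename (Fin.succAboveEmb (Fin.last m)) (A j) * X (Fin.last m) ^ (j : ℕ)))
    (hdiv : ∀ j, A j = X i ^ (d - (j : ℕ)) * A' j) {pt : Fin (m + 1) → k}
    (hconv : ∀ l, (fun l : Fin (m + 1) => if l = Fin.castSucc i ∨ l = Fin.last m then (1 : ℕ) else 0) l = 0 → pt l = 0)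
    (hγ : pt (Fin.last m) ≠ 0) (i' : Fin (m + 1)) :
    (δ.transform Φ₀ (fun l : Fin (m + 1) => if l = Fin.castSucc i ∨ l = Fin.last m then (1 : ℕ) else 0) pt i').o = 0 := by
  have h0 := constantCoeff_strict_curve_ne_zero_of_gamma_ne_zero hperm hf hU hA hP hdiv hconv hγ i'
  have hord : (δ.strict Φ₀ (fun l : Fin (m + 1) => if l = Fin.castSucc i ∨ l = Fin.last m then (1 : ℕ) else 0) pt i').order = 0 := by
    by_contra hne
    exact h0 (order_ne_zero_iff_constCoeff_eq_zero.mp hne)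
  have hle := order_sqfRep_le (δ.strict Φ₀ (fun l : Fin (m + 1) => if l = Fin.castSucc i ∨ l = Fin.last m then (1 : ℕ) else 0) pt i')
  rw [hord, nonpos_iff_eq_zero] at hle
  rw [Decoration.transform_o, hle]; rfl

open scoped Classical in
/-- **ANSWERS WITH `γ = 0`: THE STRICT TRANSFORM TIMES THE THROUGH-GOING OLD LETTERS IS THE SUCCESSOR MONIC FORM** (up to a unit), at the live
slot `u_i` (`c_i = pt(u_i) ≠ 0`): `strict · ∏_{l∈O, pt_{σl}=0} x_{σl↓} = V · (y^d + Σ_j c_i^{d−j}·(A′_j ∘ chart′_{e_i}(c_i))|_i · y^j)` — verbatim the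
successor dressed form of `moveClause_curve_dressedMonic`. [OURS · L1 W4.3] -/
theorem strict_curve_mul_prod_eq_of_gamma_eq_zero
    (hperm : IsBPermissible δ Φ₀ (fun l : Fin (m + 1) => if l = Fin.castSucc i ∨ l = Fin.last m then (1 : ℕ) else 0)) (hf : δ.f ≠ 0)
    (hU : constantCoeff U ≠ 0)
    (hP : subst Φ₀ (δ.f * ∏ l ∈ δ.O, X l) =
      U * (X (Fin.last m) ^ d + ∑ j : Fin d, rename (Fin.succAboveEmb (Fin.last m)) (A j) * X (Fin.last m) ^ (j : ℕ)))
    (hdiv : ∀ j, A j = X i ^ (d - (j : ℕ)) * A' j) {pt : Fin (m + 1) → k}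
    (hconv : ∀ l, (fun l : Fin (m + 1) => if l = Fin.castSucc i ∨ l = Fin.last m then (1 : ℕ) else 0) l = 0 → pt l = 0)
    (hγ : pt (Fin.last m) = 0) (hci : pt (Fin.castSucc i) ≠ 0) :
    ∃ V : MvPowerSeries (Fin (m + 1)) k, constantCoeff V ≠ 0 ∧
      δ.strict Φ₀ (fun l : Fin (m + 1) => if l = Fin.castSucc i ∨ l = Fin.last m then (1 : ℕ) else 0) pt (Fin.castSucc i) *
          ∏ l ∈ δ.O.filter (fun l => pt (strIdx Φ₀ l) = 0), X (Fin.predAbove (Fin.castSucc i) (strIdx Φ₀ l).succ) =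
        V * (X (Fin.last m) ^ d +
          ∑ j : Fin d, rename (Fin.succAboveEmb (Fin.last m)) (C (pt (Fin.castSucc i) ^ (d - (j : ℕ))) * TupleGame.slice i
            (subst (CobordantChart.chart (fun l : Fin m => if l = i then (1 : ℕ) else 0)
              (fun l : Fin m => if l = i then pt (Fin.castSucc i) else 0)) (A' j))) * X (Fin.last m) ^ (j : ℕ)) := by
  classical
  set Wt : Fin (m + 1) → ℕ := fun l => if l = Fin.castSucc i ∨ l = Fin.last m then (1 : ℕ) else 0 with hWt
  set w' : Fin m → ℕ := fun l => if l = i then (1 : ℕ) else 0 with hw'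
  obtain ⟨W, hW0, hcore⟩ := satPart_fChart_curve_mul_eq hperm hf hU hP hdiv pt hconv
  set s₁ : Fin (m + 1) := Fin.castSucc i with hs₁
  set ci : k := pt (Fin.castSucc i) with hci'
  have hUc : constantCoeff (subst (CobordantChart.chart Wt pt) U) ≠ 0 := by
    rw [constantCoeff_subst_of_constantCoeff_zero _ (CobordantArc.constantCoeff_chart _ pt hconv) U]; exact hU
  set Gt : Fin d → MvPowerSeries (Fin (m + 1)) k :=
    fun j => subst (cruxChart k w' (fun l => pt (Fin.castSucc l))) (A' j) with hGt
  -- slice the core identity at `u_i`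
  have h := congrArg (TupleGame.slice s₁) hcore
  have hsplit : ∏ l ∈ δ.O, TupleGame.slice s₁ (C (pt (strIdx Φ₀ l)) + X (strIdx Φ₀ l).succ : MvPowerSeries (Fin (m + 1 + 1)) k) =
      (∏ l ∈ δ.O.filter (fun l => pt (strIdx Φ₀ l) ≠ 0), TupleGame.slice s₁ (C (pt (strIdx Φ₀ l)) + X (strIdx Φ₀ l).succ)) *
        ∏ l ∈ δ.O.filter (fun l => pt (strIdx Φ₀ l) = 0), X (Fin.predAbove s₁ (strIdx Φ₀ l).succ) := by
    rw [← Finset.prod_filter_mul_prod_filter_not δ.O (fun l => pt (strIdx Φ₀ l) ≠ 0)]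
    congr 1
    refine Finset.prod_congr (by ext l; simp) fun l hl => ?_
    have hl0 : pt (strIdx Φ₀ l) = 0 := by simpa using (Finset.mem_filter.mp hl).2
    have hli : strIdx Φ₀ l ≠ s₁ := fun h' => hci (by rw [hci', ← hs₁, ← h']; exact hl0)
    rw [hl0, map_zero, zero_add, slice_X_succ_of_ne hli]
  have hchart' : cruxChart k w' (fun l => pt (Fin.castSucc l)) = CobordantChart.chart w' (fun l : Fin m => if l = i then ci else 0) := by
    have hc : (fun l : Fin m => if l = i then ci else 0) = fun l => if 0 < w' l then pt (Fin.castSucc l) else 0 := by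
      funext l
      rw [hw']
      dsimp only
      by_cases hli : l = i
      · rw [if_pos hli, if_pos (by rw [if_pos hli]; exact one_pos), hli]
      · rw [if_neg hli, if_neg (by rw [if_neg hli]; exact lt_irrefl 0)]
    rw [hc]
    exact CobordantChart.cruxChart_eq_chart w' _
  have hg₀ : TupleGame.slice s₁ ((C (pt (Fin.last m)) + X (Fin.last (m + 1))) ^ d +
      ∑ j : Fin d, (C ci + X (Fin.castSucc i).succ) ^ (d - (j : ℕ)) * rename (Fin.succAboveEmb (Fin.last (m + 1))) (Gt j) *
        (C (pt (Fin.last m)) + X (Fin.last (m + 1))) ^ (j : ℕ)) =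
      X (Fin.last m) ^ d + ∑ j : Fin d, rename (Fin.succAboveEmb (Fin.last m)) (C (ci ^ (d - (j : ℕ))) * TupleGame.slice i
        (subst (CobordantChart.chart w' (fun l : Fin m => if l = i then ci else 0)) (A' j))) * X (Fin.last m) ^ (j : ℕ) := by
    rw [hγ]
    unfold TupleGame.slice
    rw [hs₁, slice_g₀ i ci Gt]
    simp only [hGt, hchart']
    rfl
  rw [slice_mul, slice_mul, slice_mul, slice_finset_prod, hsplit, hg₀] at h
  -- divide by the unit
  set Wu : MvPowerSeries (Fin (m + 1)) k := TupleGame.slice s₁ W *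
    ∏ l ∈ δ.O.filter (fun l => pt (strIdx Φ₀ l) ≠ 0), TupleGame.slice s₁ (C (pt (strIdx Φ₀ l)) + X (strIdx Φ₀ l).succ) with hWu
  have hWu0 : constantCoeff Wu ≠ 0 := by
    rw [hWu, map_mul, WildTerminal.constantCoeff_slice, map_prod]
    refine mul_ne_zero hW0 (Finset.prod_ne_zero_iff.mpr fun l hl => ?_)
    rw [WildTerminal.constantCoeff_slice, map_add, constantCoeff_C, constantCoeff_X, add_zero]
    simpa using (Finset.mem_filter.mp hl).2
  obtain ⟨wu, hwu⟩ := isUnit_iff_constantCoeff.mpr (Ne.isUnit hWu0)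
  have hinv0 : constantCoeff (↑wu⁻¹ : MvPowerSeries (Fin (m + 1)) k) ≠ 0 :=
    ((wu⁻¹).isUnit.map (constantCoeff : MvPowerSeries (Fin (m + 1)) k →+* k)).ne_zero
  refine ⟨TupleGame.slice s₁ (subst (CobordantChart.chart Wt pt) U) * ↑wu⁻¹, ?_, ?_⟩
  · rw [map_mul, WildTerminal.constantCoeff_slice]; exact mul_ne_zero hUc hinv0
  · have hkey : δ.strict Φ₀ Wt pt s₁ * Wu *
        ∏ l ∈ δ.O.filter (fun l => pt (strIdx Φ₀ l) = 0), X (Fin.predAbove s₁ (strIdx Φ₀ l).succ) =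
        TupleGame.slice s₁ (subst (CobordantChart.chart Wt pt) U) * (X (Fin.last m) ^ d +
          ∑ j : Fin d, rename (Fin.succAboveEmb (Fin.last m)) (C (ci ^ (d - (j : ℕ))) * TupleGame.slice i
            (subst (CobordantChart.chart w' (fun l : Fin m => if l = i then ci else 0)) (A' j))) * X (Fin.last m) ^ (j : ℕ)) := by
      rw [← h, hWu]; unfold Decoration.strict; ring
    calc δ.strict Φ₀ Wt pt s₁ * ∏ l ∈ δ.O.filter (fun l => pt (strIdx Φ₀ l) = 0), X (Fin.predAbove s₁ (strIdx Φ₀ l).succ)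
        = δ.strict Φ₀ Wt pt s₁ * (∏ l ∈ δ.O.filter (fun l => pt (strIdx Φ₀ l) = 0), X (Fin.predAbove s₁ (strIdx Φ₀ l).succ)) *
            ↑wu * ↑wu⁻¹ := (Units.mul_inv_cancel_right _ wu).symm
      _ = δ.strict Φ₀ Wt pt s₁ * Wu *
            (∏ l ∈ δ.O.filter (fun l => pt (strIdx Φ₀ l) = 0), X (Fin.predAbove s₁ (strIdx Φ₀ l).succ)) * ↑wu⁻¹ := by rw [hwu]; ring
      _ = TupleGame.slice s₁ (subst (CobordantChart.chart Wt pt) U) * (X (Fin.last m) ^ d +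
            ∑ j : Fin d, rename (Fin.succAboveEmb (Fin.last m)) (C (ci ^ (d - (j : ℕ))) * TupleGame.slice i
              (subst (CobordantChart.chart w' (fun l : Fin m => if l = i then ci else 0)) (A' j))) * X (Fin.last m) ^ (j : ℕ)) * ↑wu⁻¹ := by
          rw [hkey]
      _ = _ := by ring

open scoped Classical in
/-- **AT A NEAR ANSWER OF THE CURVE MOVE THE NEW `f′ · ∏_{O′} x_l` IS THE SUCCESSOR MONIC FORM** (up to a unit): if the order did not drop
(`(δ.transform …).o = δ.o`, so `f′` is the actual sliced strict transform and `O′` the through-going old letters — S-SET 8), then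
`f′ · ∏_{l∈O′} x_l = V · (y^d + Σ_j c_i^{d−j}·(A′_j ∘ chart′)|_i · y^j)`; with …TOT2BridgeLabels `monicForm_curveSucc_zero/one` (`m = 2`) this is
`unit · Θ^*(monic form of divOneT/divTwoT of the label)`, the presentation of the next step after `Θ⁻¹` (`exists_legal_inverse`). [OURS · L1 W4.3] -/
theorem totalO_transform_curve_eq_of_near
    (hperm : IsBPermissible δ Φ₀ (fun l : Fin (m + 1) => if l = Fin.castSucc i ∨ l = Fin.last m then (1 : ℕ) else 0)) (hf : δ.f ≠ 0)
    (hU : constantCoeff U ≠ 0)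
    (hP : subst Φ₀ (δ.f * ∏ l ∈ δ.O, X l) =
      U * (X (Fin.last m) ^ d + ∑ j : Fin d, rename (Fin.succAboveEmb (Fin.last m)) (A j) * X (Fin.last m) ^ (j : ℕ)))
    (hdiv : ∀ j, A j = X i ^ (d - (j : ℕ)) * A' j) {pt : Fin (m + 1) → k}
    (hconv : ∀ l, (fun l : Fin (m + 1) => if l = Fin.castSucc i ∨ l = Fin.last m then (1 : ℕ) else 0) l = 0 → pt l = 0)
    (hγ : pt (Fin.last m) = 0) (hci : pt (Fin.castSucc i) ≠ 0)
    (hnear : (δ.transform Φ₀ (fun l : Fin (m + 1) => if l = Fin.castSucc i ∨ l = Fin.last m then (1 : ℕ) else 0) pt (Fin.castSucc i)).o = δ.o) :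
    ∃ V : MvPowerSeries (Fin (m + 1)) k, constantCoeff V ≠ 0 ∧
      (δ.transform Φ₀ (fun l : Fin (m + 1) => if l = Fin.castSucc i ∨ l = Fin.last m then (1 : ℕ) else 0) pt (Fin.castSucc i)).f *
          ∏ l ∈ (δ.transform Φ₀ (fun l : Fin (m + 1) => if l = Fin.castSucc i ∨ l = Fin.last m then (1 : ℕ) else 0) pt (Fin.castSucc i)).O, X l =
        V * (X (Fin.last m) ^ d +
          ∑ j : Fin d, rename (Fin.succAboveEmb (Fin.last m)) (C (pt (Fin.castSucc i) ^ (d - (j : ℕ))) * TupleGame.slice i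
            (subst (CobordantChart.chart (fun l : Fin m => if l = i then (1 : ℕ) else 0)
              (fun l : Fin m => if l = i then pt (Fin.castSucc i) else 0)) (A' j))) * X (Fin.last m) ^ (j : ℕ)) := by
  classical
  obtain ⟨V, hV, heq⟩ := strict_curve_mul_prod_eq_of_gamma_eq_zero hperm hf hU hP hdiv hconv hγ hci
  refine ⟨V, hV, ?_⟩
  have hO : (δ.transform Φ₀ (fun l : Fin (m + 1) => if l = Fin.castSucc i ∨ l = Fin.last m then (1 : ℕ) else 0) pt (Fin.castSucc i)).O =
      Decoration.newLetters δ.O Φ₀ pt (Fin.castSucc i) := by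
    refine Decoration.transform_O_of_not_lt δ Φ₀ _ pt _ ?_
    rw [← Decoration.transform_o, hnear]; exact lt_irrefl _
  rw [Decoration.transform_f_eq_strict_of_o_transform_eq hperm hconv hf hci hnear, hO,
    Decoration.prod_X_newLetters hperm pt hci δ.O_subset]
  exact heq

/-! ## From a point-B-permissible presentation (the `DPres` shape) -/

/-- `γ ≠ 0` answers of the curve move are head drops — from a POINT-B-permissible presenting `Φ₀` (curve B-permissibility by
`isBPermissible_curve_of_presentation`, res-L1-w43-lead-1 p535609). [OURS · L1 W4.3] -/
theorem o_transform_curve_eq_zero_of_gamma_ne_zero' (hperm₁ : IsBPermissible δ Φ₀ (fun _ => 1)) (hf : δ.f ≠ 0)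
    (hU : constantCoeff U ≠ 0) (hA : ∀ j : Fin d, ((d - (j : ℕ) : ℕ) : ℕ∞) < (A j).order)
    (hP : subst Φ₀ (δ.f * ∏ l ∈ δ.O, X l) =
      U * (X (Fin.last m) ^ d + ∑ j : Fin d, rename (Fin.succAboveEmb (Fin.last m)) (A j) * X (Fin.last m) ^ (j : ℕ)))
    (hdiv : ∀ j, A j = X i ^ (d - (j : ℕ)) * A' j) {pt : Fin (m + 1) → k}
    (hconv : ∀ l, (fun l : Fin (m + 1) => if l = Fin.castSucc i ∨ l = Fin.last m then (1 : ℕ) else 0) l = 0 → pt l = 0)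
    (hγ : pt (Fin.last m) ≠ 0) (i' : Fin (m + 1)) :
    (δ.transform Φ₀ (fun l : Fin (m + 1) => if l = Fin.castSucc i ∨ l = Fin.last m then (1 : ℕ) else 0) pt i').o = 0 :=
  o_transform_curve_eq_zero_of_gamma_ne_zero (isBPermissible_curve_of_presentation hperm₁ hf i hdiv hU hP) hf hU hA hP hdiv hconv hγ i'

open scoped Classical in
/-- The near-answer reading of the curve move — from a POINT-B-permissible presenting `Φ₀` (the `DPres` shape; curve B-permissibility by
`isBPermissible_curve_of_presentation`, res-L1-w43-lead-1 p535609). [OURS · L1 W4.3] -/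
theorem totalO_transform_curve_eq_of_near' (hperm₁ : IsBPermissible δ Φ₀ (fun _ => 1)) (hf : δ.f ≠ 0) (hU : constantCoeff U ≠ 0)
    (hP : subst Φ₀ (δ.f * ∏ l ∈ δ.O, X l) =
      U * (X (Fin.last m) ^ d + ∑ j : Fin d, rename (Fin.succAboveEmb (Fin.last m)) (A j) * X (Fin.last m) ^ (j : ℕ)))
    (hdiv : ∀ j, A j = X i ^ (d - (j : ℕ)) * A' j) {pt : Fin (m + 1) → k}
    (hconv : ∀ l, (fun l : Fin (m + 1) => if l = Fin.castSucc i ∨ l = Fin.last m then (1 : ℕ) else 0) l = 0 → pt l = 0)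
    (hγ : pt (Fin.last m) = 0) (hci : pt (Fin.castSucc i) ≠ 0)
    (hnear : (δ.transform Φ₀ (fun l : Fin (m + 1) => if l = Fin.castSucc i ∨ l = Fin.last m then (1 : ℕ) else 0) pt (Fin.castSucc i)).o = δ.o) :
    ∃ V : MvPowerSeries (Fin (m + 1)) k, constantCoeff V ≠ 0 ∧
      (δ.transform Φ₀ (fun l : Fin (m + 1) => if l = Fin.castSucc i ∨ l = Fin.last m then (1 : ℕ) else 0) pt (Fin.castSucc i)).f *
          ∏ l ∈ (δ.transform Φ₀ (fun l : Fin (m + 1) => if l = Fin.castSucc i ∨ l = Fin.last m then (1 : ℕ) else 0) pt (Fin.castSucc i)).O, X l =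
        V * (X (Fin.last m) ^ d +
          ∑ j : Fin d, rename (Fin.succAboveEmb (Fin.last m)) (C (pt (Fin.castSucc i) ^ (d - (j : ℕ))) * TupleGame.slice i
            (subst (CobordantChart.chart (fun l : Fin m => if l = i then (1 : ℕ) else 0)
              (fun l : Fin m => if l = i then pt (Fin.castSucc i) else 0)) (A' j))) * X (Fin.last m) ^ (j : ℕ)) :=
  totalO_transform_curve_eq_of_near (isBPermissible_curve_of_presentation hperm₁ hf i hdiv hU hP) hf hU hP hdiv hconv hγ hci hnear

end Core

end TameFourTupleDrop

end Summit.ResolutionOfSingularities.ResolutionOfSingularities.Theorems
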